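import Literature.Analysis.FluidPDE.CylindricalCutoff
import HarnessLib

/-!
# Lei–Ren–Zhang 2019, §§2–3: space–time integrability of the tested equation per period

Analysis/FluidPDE proofs file (theorems only, no definitions, no named facts), on the discharge
path of the named fact `Literature.Analysis.FluidPDE.leiRenZhang2019_liouville_periodic`
(Z. Lei, X. Ren, Q. S. Zhang, arXiv:1902.11229 = Math. Ann. 383 (2022), Theorem 1.1). Every
energy computation of §§2–3 ("by direct computations … using the cut-off function and
integration by parts", (2.4), (3.3), Lemma 3.3) is run in the tree through
`energy_identity_axis_periodic`, whose one analytic hypothesis `hint` is the space–time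
integrability of the tested equation `(H'(F) N η + H(F) η') φ̃²` with the window cut-off
`φ̃ = ψ(x) ω(x₂)`. This file proves that integrability once and for all from the data of the
periodic swirl setting (`bundle_of_periodic_swirl_setting`: `N` jointly a.e.-measurable on
`(−ρ², 0] × ℝ³` and integrable on `(−ρ², 0] × {0 ≤ x₂ ≤ 2P, r ≤ ρ}`), for `F` jointly continuous,
`H ∈ C¹`, a bounded `C⁰` time weight with bounded derivative, and a bounded continuous spatial
cut-off vanishing for `r ≥ r₁` (`r₁ ≤ ρ`) — the argument of `reverse_holder_between_periodCylinders`
(dominating function `1_K (C_H' |N| + C_H C_η')` on the compact two-period box `K`).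

* `integrable_testedEquation_window`.

## References

* Z. Lei, X. Ren, Q. S. Zhang, arXiv:1902.11229, §2 (2.4) and §3 (3.3), Lemma 3.3 (arXiv pp. 5–9).
  [LeiRenZhang2019]
-/

noncomputable section

open MeasureTheory Set Function Filter Metric
open _root_.Topology

namespace Literature.Analysis.FluidPDE

namespace LeiRenZhang2019

/-- The closed box `[0, L] × {r ≤ ρ}` is compact. [folklore] -/
private theorem isCompact_box_pte (L ρ : ℝ) :
    IsCompact {x : EuclideanSpace ℝ (Fin 3) | x 2 ∈ Icc 0 L ∧ cylRadius x ≤ ρ} := by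
  have hx2 : Continuous fun x : EuclideanSpace ℝ (Fin 3) => x 2 :=
    (EuclideanSpace.proj (𝕜 := ℝ) (2 : Fin 3)).continuous
  refine Metric.isCompact_of_isClosed_isBounded ?_ ?_
  · exact (isClosed_Icc.preimage hx2).inter (isClosed_le continuous_cylRadius continuous_const)
  · refine (Metric.isBounded_closedBall (x := (0 : EuclideanSpace ℝ (Fin 3))) (r := ρ + |L|)).subset
      fun x hx => ?_
    rw [mem_closedBall_zero_iff]
    have h := norm_le_cylRadius_add_abs_apply_two x
    have h2 : |x 2| ≤ |L| := by
      rw [abs_le]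
      exact ⟨by linarith [hx.1.1, abs_nonneg L], hx.1.2.trans (le_abs_self L)⟩
    linarith [hx.2]

set_option maxHeartbeats 800000 in
/-- **Space–time integrability of the tested equation with the window cut-off** (the hypothesis
`hint` of `energy_identity_axis_periodic`, for the data of the periodic swirl setting). Let `F`
be jointly continuous, `N` a.e.-strongly measurable on `(−ρ², 0] × ℝ³` and integrable on
`(−ρ², 0] × {0 ≤ x₂ ≤ 2P, r ≤ ρ}`, `H ∈ C¹`, `η` continuous with `|η| ≤ C_η` and
`deriv η` continuous with `|η'| ≤ C_η'`, `ψ` continuous with `|ψ| ≤ C_ψ` and `ψ = 0` for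
`r ≥ r₁`, `r₁ ≤ ρ`, `P > 0`, `−ρ² ≤ t₁`, `t₂ ≤ 0`. Then
`(H'(F) N η + H(F) η') (ψ ω(x₂))²` is integrable on `(t₁, t₂] × ℝ³`. [cite: LeiRenZhang2019, §2 (2.4) and §3 (3.3) (arXiv pp. 5, 7: testing the equation with the cut-off functions)] -/
theorem integrable_testedEquation_window {P ρ r₁ t₁ t₂ : ℝ} (hP : 0 < P) (hr₁ρ : r₁ ≤ ρ)
    (ht₁ : -ρ ^ 2 ≤ t₁) (ht₂ : t₂ ≤ 0)
    {F N : ℝ → EuclideanSpace ℝ (Fin 3) → ℝ}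
    (hFc : Continuous fun p : ℝ × EuclideanSpace ℝ (Fin 3) => F p.1 p.2)
    (hNm : AEStronglyMeasurable (fun p : ℝ × EuclideanSpace ℝ (Fin 3) => N p.1 p.2)
      ((volume.restrict (Ioc (-ρ ^ 2) 0)).prod volume))
    (hNi : Integrable (fun p : ℝ × EuclideanSpace ℝ (Fin 3) => N p.1 p.2)
      ((volume.restrict (Ioc (-ρ ^ 2) 0)).prod
        (volume.restrict {x : EuclideanSpace ℝ (Fin 3) | x 2 ∈ Icc 0 (2 * P) ∧ cylRadius x ≤ ρ})))
    {H : ℝ → ℝ} (hH : ContDiff ℝ 1 H)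
    {η : ℝ → ℝ} (hηc : Continuous η) (hη'c : Continuous (deriv η)) {Cη Cη' : ℝ}
    (hηb : ∀ s, |η s| ≤ Cη) (hη'b : ∀ s, |deriv η s| ≤ Cη')
    {ψ : EuclideanSpace ℝ (Fin 3) → ℝ} (hψc : Continuous ψ) {Cψ : ℝ} (hψb : ∀ x, |ψ x| ≤ Cψ)
    (hψ0 : ∀ x, r₁ ≤ cylRadius x → ψ x = 0) :
    Integrable (fun p : ℝ × EuclideanSpace ℝ (Fin 3) =>
      (deriv H (F p.1 p.2) * N p.1 p.2 * η p.1 + H (F p.1 p.2) * deriv η p.1) *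
        (ψ p.2 * periodicWindow P (p.2 2)) ^ 2) ((volume.restrict (Ioc t₁ t₂)).prod volume) := by
  have hI : Ioc t₁ t₂ ⊆ Ioc (-ρ ^ 2) 0 := Ioc_subset_Ioc ht₁ ht₂
  -- the two-period support box
  set K : Set (EuclideanSpace ℝ (Fin 3)) := {x | x 2 ∈ Icc 0 (2 * P) ∧ cylRadius x ≤ r₁} with hK
  have hKc : IsCompact K := isCompact_box_pte (2 * P) r₁
  have hKρ : K ⊆ {x : EuclideanSpace ℝ (Fin 3) | x 2 ∈ Icc 0 (2 * P) ∧ cylRadius x ≤ ρ} :=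
    fun x hx => ⟨hx.1, hx.2.trans hr₁ρ⟩
  -- the window cut-off vanishes off `K`
  have hω0 : ∀ z, z ∉ Icc (0 : ℝ) (2 * P) → periodicWindow P z = 0 := by
    intro z hz
    by_contra h
    have hm := mem_Ioo_of_periodicWindow_ne_zero hP h
    exact hz ⟨hm.1.le, hm.2.le⟩
  have hφt0K : ∀ x, x ∉ K → ψ x * periodicWindow P (x 2) = 0 := by
    intro x hx
    by_cases h1 : r₁ ≤ cylRadius x
    · rw [hψ0 x h1, zero_mul]
    · have h2 : x 2 ∉ Icc (0 : ℝ) (2 * P) := fun h => hx ⟨h, (not_le.1 h1).le⟩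
      rw [hω0 _ h2, mul_zero]
  -- bounds for `H(F)`, `H'(F)` on `[t₁, t₂] × K`
  have hHFc : Continuous fun p : ℝ × EuclideanSpace ℝ (Fin 3) => H (F p.1 p.2) := hH.continuous.comp hFc
  have hH'c : Continuous (deriv H) := hH.continuous_deriv le_rfl
  have hH'Fc : Continuous fun p : ℝ × EuclideanSpace ℝ (Fin 3) => deriv H (F p.1 p.2) := hH'c.comp hFc
  have hcpt : IsCompact (Icc t₁ t₂ ×ˢ K) := isCompact_Icc.prod hKc
  obtain ⟨CH, hCH⟩ : ∃ C, ∀ p ∈ Icc t₁ t₂ ×ˢ K, ‖H (F p.1 p.2)‖ ≤ C :=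
    hcpt.exists_bound_of_continuousOn hHFc.continuousOn
  obtain ⟨CH', hCH'⟩ : ∃ C, ∀ p ∈ Icc t₁ t₂ ×ˢ K, ‖deriv H (F p.1 p.2)‖ ≤ C :=
    hcpt.exists_bound_of_continuousOn hH'Fc.continuousOn
  have hCψ0 : 0 ≤ Cψ := (abs_nonneg _).trans (hψb 0)
  have hCη0 : 0 ≤ Cη := (abs_nonneg _).trans (hηb 0)
  have hCη'0 : 0 ≤ Cη' := (abs_nonneg _).trans (hη'b 0)
  set μ₁ : Measure (ℝ × EuclideanSpace ℝ (Fin 3)) := (volume.restrict (Ioc t₁ t₂)).prod volume with hμ₁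
  have hNm₁ : AEStronglyMeasurable (fun p : ℝ × EuclideanSpace ℝ (Fin 3) => N p.1 p.2) μ₁ :=
    hNm.mono_measure (Measure.prod_mono (Measure.restrict_mono hI le_rfl) le_rfl)
  have hφtc : Continuous fun x : EuclideanSpace ℝ (Fin 3) => ψ x * periodicWindow P (x 2) :=
    hψc.mul ((contDiff_periodicWindow P (n := 1)).continuous.comp
      (EuclideanSpace.proj (𝕜 := ℝ) (2 : Fin 3)).continuous)
  have hfm : AEStronglyMeasurable (fun p : ℝ × EuclideanSpace ℝ (Fin 3) =>
      (deriv H (F p.1 p.2) * N p.1 p.2 * η p.1 + H (F p.1 p.2) * deriv η p.1) *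
        (ψ p.2 * periodicWindow P (p.2 2)) ^ 2) μ₁ := by
    refine AEStronglyMeasurable.mul (AEStronglyMeasurable.add ?_ ?_) ?_
    · exact (hH'Fc.aestronglyMeasurable.mul hNm₁).mul (hηc.comp continuous_fst).aestronglyMeasurable
    · exact (hHFc.mul (hη'c.comp continuous_fst)).aestronglyMeasurable
    · exact ((hφtc.comp continuous_snd).pow 2).aestronglyMeasurable
  -- the dominating function `1_K(x) C_ψ² (C_H' C_η |N| + C_H C_η')`
  set g : ℝ × EuclideanSpace ℝ (Fin 3) → ℝ := fun p =>
    (univ ×ˢ K : Set (ℝ × EuclideanSpace ℝ (Fin 3))).indicator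
      (fun p => Cψ ^ 2 * (CH' * Cη * ‖N p.1 p.2‖ + CH * Cη')) p with hg
  have hgi : Integrable g μ₁ := by
    rw [hg, integrable_indicator_iff (MeasurableSet.univ.prod hKc.isClosed.measurableSet)]
    have hres : μ₁.restrict (univ ×ˢ K) = (volume.restrict (Ioc t₁ t₂)).prod (volume.restrict K) := by
      rw [hμ₁, ← Measure.restrict_univ (μ := volume.restrict (Ioc t₁ t₂)),
        Measure.prod_restrict, Measure.restrict_univ]
    rw [IntegrableOn, hres]
    have hNi₁ : Integrable (fun p : ℝ × EuclideanSpace ℝ (Fin 3) => N p.1 p.2)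
        ((volume.restrict (Ioc t₁ t₂)).prod (volume.restrict K)) :=
      hNi.mono_measure (Measure.prod_mono (Measure.restrict_mono hI le_rfl) (Measure.restrict_mono hKρ le_rfl))
    haveI : IsFiniteMeasure ((volume.restrict (Ioc t₁ t₂)).prod (volume.restrict K)) := by
      haveI : IsFiniteMeasure (volume.restrict (Ioc t₁ t₂)) := ⟨by
        rw [Measure.restrict_apply_univ]; exact measure_Ioc_lt_top⟩
      haveI : IsFiniteMeasure ((volume : Measure (EuclideanSpace ℝ (Fin 3))).restrict K) := ⟨by
        rw [Measure.restrict_apply_univ]; exact hKc.measure_lt_top⟩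
      infer_instance
    exact ((hNi₁.norm.const_mul (CH' * Cη)).add (integrable_const _)).const_mul _
  refine hgi.mono' hfm ?_
  have hmem : ∀ᵐ p ∂μ₁, p.1 ∈ Ioc t₁ t₂ := by
    rw [hμ₁, Measure.restrict_prod_eq_prod_univ]
    filter_upwards [ae_restrict_mem (measurableSet_Ioc.prod MeasurableSet.univ)] with p hp
    exact hp.1
  filter_upwards [hmem] with p hp
  have h5 : (ψ p.2 * periodicWindow P (p.2 2)) ^ 2 ≤ Cψ ^ 2 := by
    have hω := periodicWindow_nonneg P (p.2 2)
    have hω1 := periodicWindow_le_one P (p.2 2)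
    have h1 : |ψ p.2 * periodicWindow P (p.2 2)| ≤ Cψ := by
      rw [abs_mul, abs_of_nonneg hω]
      calc |ψ p.2| * periodicWindow P (p.2 2) ≤ Cψ * 1 := mul_le_mul (hψb p.2) hω1 hω hCψ0
        _ = Cψ := mul_one _
    calc (ψ p.2 * periodicWindow P (p.2 2)) ^ 2 = |ψ p.2 * periodicWindow P (p.2 2)| ^ 2 := (sq_abs _).symm
      _ ≤ Cψ ^ 2 := pow_le_pow_left₀ (abs_nonneg _) h1 2
  by_cases hx : p.2 ∈ K
  · have hpI : p ∈ Icc t₁ t₂ ×ˢ K := ⟨Ioc_subset_Icc_self hp, hx⟩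
    simp only [hg]
    rw [indicator_of_mem (show p ∈ (univ ×ˢ K : Set _) from ⟨mem_univ _, hx⟩)]
    have h1 : ‖deriv H (F p.1 p.2)‖ ≤ CH' := hCH' p hpI
    have h2 : ‖H (F p.1 p.2)‖ ≤ CH := hCH p hpI
    have h3 : |η p.1| ≤ Cη := hηb p.1
    have h4 : |deriv η p.1| ≤ Cη' := hη'b p.1
    have hCH0 : 0 ≤ CH := (norm_nonneg _).trans h2
    have hCH'0 : 0 ≤ CH' := (norm_nonneg _).trans h1
    rw [Real.norm_eq_abs, abs_mul, abs_of_nonneg (sq_nonneg (ψ p.2 * periodicWindow P (p.2 2)))]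
    have hA : |deriv H (F p.1 p.2) * N p.1 p.2 * η p.1 + H (F p.1 p.2) * deriv η p.1| ≤
        CH' * Cη * ‖N p.1 p.2‖ + CH * Cη' := by
      refine (abs_add_le _ _).trans ?_
      rw [abs_mul, abs_mul, abs_mul, Real.norm_eq_abs]
      refine add_le_add ?_ ?_
      · calc |deriv H (F p.1 p.2)| * |N p.1 p.2| * |η p.1| ≤ CH' * |N p.1 p.2| * Cη :=
            mul_le_mul (mul_le_mul_of_nonneg_right ((Real.norm_eq_abs _).symm.le.trans h1) (abs_nonneg _))
              h3 (abs_nonneg _) (by positivity)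
          _ = CH' * Cη * |N p.1 p.2| := by ring
      · exact mul_le_mul ((Real.norm_eq_abs _).symm.le.trans h2) h4 (abs_nonneg _) hCH0
    have hA0 : 0 ≤ CH' * Cη * ‖N p.1 p.2‖ + CH * Cη' := by positivity
    calc |deriv H (F p.1 p.2) * N p.1 p.2 * η p.1 + H (F p.1 p.2) * deriv η p.1| *
          (ψ p.2 * periodicWindow P (p.2 2)) ^ 2
        ≤ (CH' * Cη * ‖N p.1 p.2‖ + CH * Cη') * Cψ ^ 2 := mul_le_mul hA h5 (sq_nonneg _) hA0
      _ = Cψ ^ 2 * (CH' * Cη * ‖N p.1 p.2‖ + CH * Cη') := mul_comm _ _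
  · rw [hφt0K p.2 hx]
    simp only [hg]
    rw [indicator_of_notMem (show p ∉ (univ ×ˢ K : Set _) from fun h => hx h.2)]
    simp
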